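import Literature.AlgebraicGeometry.VanGeemen1994.HyperbolicOfSplitDiscriminant
import HarnessLib

/-!
# The rational Weil datum of an abelian variety of Weil type has signature `(n, n)` (van Geemen, Lemma 5.2 (4), on the datum)

Family `hodge`, layer `Literature/AlgebraicGeometry/HodgeTheory`; theorems only (no definition, no
named fact; D-0026). Companion of `HodgeTheory/WeilTypeRationalDatum` (`weilDatumOfKsymm`) and of
`Motives/AimedSplitProductDischarge` (`weilSignature_exists_PN`: the signature `(n, n)` of a rational
degree-one MODEL, in coordinates) / `VanGeemen1994/HyperbolicOfSplitDiscriminant`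
(`hodgeRiemann_degreeOne_ksymm`: Hodge–Riemann in degree one for the `K`-symmetrised hyperplane class).
It transports the coordinate statement to the DATUM, in the format consumed by Landherr's theorem
`Motives.exists_linearEquiv_weil_of_weilDiscriminant_eq_rat` (`α`-stable definite `ℚ`-subspaces).

Source (held, read): B. van Geemen, *An introduction to the Hodge conjecture for abelian varieties*,
LNM 1594 (1994), pp. 233–252, Lemma 5.2 (4) (p. 238 f.): "The signature of the Hermitian form `H` is
`(n, n)`"; its proof via (5), loc. cit.: `H` is definite of opposite signs on `V₊^{1,0} ⊕ V₋^{0,1}` and `V₋^{1,0} ⊕ V₊^{0,1}`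
(Hodge–Riemann in degree one); P. Deligne (notes by J. S. Milne), LNM 900 (1982), §4 Prop. 4.4
(Weil type `(n, n)` ⟺ the Weil plane is purely of type `(n, n)`) and the positivity computation of the
proof of Thm. 4.8 (`ϕ_τ > 0` on `H_τ^+`, `< 0` on `H_τ^-`; Milne's 2003 TeXed edition pp. 32–33); C. Voisin, Hodge Theory I, Thm. 6.32.

## What is proved (0 sorry)

* **`exists_signature_submodules_weilDatumOfKsymm`** — for `A` of dimension `m + 1 = 2n ≥ 2`,
  `φ ≫ φ = -d` (`d ≥ 1`), `h_K = d·e^*a + φ^*e^*a` (`a ≠ 0` rational), a rational generator `ω` of the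
  top cohomology, and a non-zero Weil class of Hodge type `(n, n)` in `weilClassesOf A φ n d` (Weil type
  `(n, n)`): the datum form `E` of `D = weilDatumOfKsymm …` satisfies `E(x, φ^*x) > 0` on a
  `φ^*_ℚ`-stable `ℚ`-subspace `P` of `H¹(A(ℂ); ℚ)` of dimension `2n` and `< 0` on such an `N`, with
  `P ⊓ N = 0`. Proof: `weilSignature_exists_PN` for the rational model `u = β ⊗ 1` of a `ℚ`-basis `β`
  (multiplicities `(n, n)` from the Weil class, `Motives.weilMultiplicity_of_mem_weilClassesOf`;
  Hodge–Riemann `hodgeRiemann_degreeOne_ksymm`), transported back along `β`.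

Consumers: `HodgeTheory/WeilTypeClassReachOfPeriodSurjective`.

## References

* [vanGeemen1994HodgeAV] B. van Geemen, LNM 1594 (1994), pp. 233–252: Lemma 5.2 (2), (4), (5) with proof (p. 238 f.).
* [Deligne1982HodgeCycles] P. Deligne, LNM 900 (1982), §4 Prop. 4.4 and proof of Thm. 4.8 (Milne 2003 TeXed ed. pp. 32–33).
* [VoisinHodgeI2002] C. Voisin, Hodge Theory and Complex Algebraic Geometry I (2002), Thm. 6.32, §7.1.1.
-/

noncomputable section

open CategoryTheory Polynomial Module
open scoped Matrix
open Literature.AlgebraicTopology.SingularHomology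
open Literature.AlgebraicGeometry.Motives
open Literature.AlgebraicGeometry.VanGeemen1994

namespace Literature.AlgebraicGeometry.HodgeTheory

/-! ### Van Geemen 5.2 (4) on the datum: signature `(n, n)` in Landherr's format -/

section Signature

variable {m n d : ℕ} {A : AbelianVariety ℂ} {φ : A ⟶ A}

/-- **The rational Weil datum of an abelian variety of Weil type `(n, n)` has signature `(n, n)`**
(van Geemen 1994, Lemma 5.2 (4): "The signature of the Hermitian form `H` is `(n, n)`"; proof (5):
`H` is definite of opposite signs on `V₊^{1,0} ⊕ V₋^{0,1}` and `V₋^{1,0} ⊕ V₊^{0,1}` by Hodge–Riemann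
in degree one), in Landherr's format on the DATUM `D = (H¹(A(ℂ); ℚ), φ^*_ℚ, E)` of
`h_K = d·e^*a + φ^*e^*a` along `ω` (`weilDatumOfKsymm`, `dim A = m + 1 = 2n ≥ 2`, `φ ≫ φ = -d`,
`d ≥ 1`): if the Weil plane `weilClassesOf A φ n d` contains a non-zero class of Hodge type `(n, n)`
(so both eigenvalues `±i√d` of `φ^*` have multiplicity `n` on `H^{1,0}`, Deligne–Milne Prop. 4.4,
`Motives.weilMultiplicity_of_mem_weilClassesOf`), then there are `φ^*_ℚ`-stable `ℚ`-subspaces `P`,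
`N` of `H¹(A(ℂ); ℚ)` of dimension `2n` each, `P ⊓ N = 0`, with `E(x, φ^*x) > 0` on `P ∖ 0` and `< 0` on
`N ∖ 0`. Proof: the tree's coordinate statement `Motives.weilSignature_exists_PN` (Hodge–Riemann for
`h_K`: `VanGeemen1994.hodgeRiemann_degreeOne_ksymm`) for the rational model `u = β ⊗ 1` given by a
`ℚ`-basis `β` of `H¹(A, ℚ)` (`φ^*`-matrix = the matrix of `φ^*_ℚ` in `β`, Gram matrix
`(E(βᵢ, βₖ))`), transported back along `β`. [cite: vanGeemen1994HodgeAV, Lemma 5.2 (2), (4), (5) with proof]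
[cite: Deligne1982HodgeCycles, §4 Prop. 4.4] [cite: VoisinHodgeI2002, Thm. 6.32] -/
theorem exists_signature_submodules_weilDatumOfKsymm (hn : 1 ≤ n) (hmn : m + 1 = 2 * n)
    (hA : A.dim = m + 1) (hd : 0 < d) (hφ : φ ≫ φ = -(d • 𝟙 A)) (e : ProjectiveEmbedding A.X)
    {a : complexBetti (projectiveSpace e.n ℂ) 2} (ha : IsRationalClass a) (ha0 : a ≠ 0)
    {ω : complexBetti A.X (2 + 2 * m)} (hω : IsRationalClass ω) (hω0 : ω ≠ 0)
    (hweil : ∃ c ∈ weilClassesOf A φ n d, c ≠ 0 ∧ IsOfHodgeType (2 * n) A.X (2 * n) n n c) :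
    ∃ P N : Submodule ℚ ↥(bettiCohomology A.X 1),
      (∀ x ∈ P, (weilDatumOfKsymm (by omega) hA hd hφ e ha ha0 hω hω0).α x ∈ P) ∧
      (∀ x ∈ N, (weilDatumOfKsymm (by omega) hA hd hφ e ha ha0 hω hω0).α x ∈ N) ∧
      Module.finrank ℚ P = 2 * n ∧ Module.finrank ℚ N = 2 * n ∧ P ⊓ N = ⊥ ∧
      (∀ x ∈ P, x ≠ 0 → 0 < (weilDatumOfKsymm (by omega) hA hd hφ e ha ha0 hω hω0).E x
        ((weilDatumOfKsymm (by omega) hA hd hφ e ha ha0 hω hω0).α x)) ∧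
      (∀ x ∈ N, x ≠ 0 → (weilDatumOfKsymm (by omega) hA hd hφ e ha ha0 hω hω0).E x
        ((weilDatumOfKsymm (by omega) hA hd hφ e ha ha0 hω hω0).α x) < 0) := by
  classical
  set D := weilDatumOfKsymm (by omega) hA hd hφ e ha ha0 hω hω0 with hDdef
  have hA2 : A.dim = 2 * n := by omega
  have hX : IsSmoothProjective (2 * n) A.X := Motives.isSmoothProjective_of_dim_eq' hA2
  have hX' : IsSmoothProjective (m + 1) A.X := Motives.isSmoothProjective_of_dim_eq' hA
  set hK := (d : ℂ) • complexBetti.map e.ι 2 a + complexBetti.map φ.hom.hom.hom 2 (complexBetti.map e.ι 2 a)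
    with hKdef
  have hhK : IsRationalClass hK := isRationalClass_ksymm d φ e ha
  have hφh : complexBetti.map φ.hom.hom.hom 2 hK = (d : ℂ) • hK := map_ksymm_eq_smul hφ _
  have h1 := Motives.finrank_complexBetti_two_add_two_mul_eq_one hX'
  haveI : Module.Finite ℚ ↥(bettiCohomology A.X 1) := finite_bettiCohomology_one A
  haveI : Module.Finite ℂ (complexBetti A.X 1) := finite_complexBetti_abelianVariety A 1
  have hV : Module.finrank ℚ ↥(bettiCohomology A.X 1) = 4 * n := by
    rw [finrank_bettiCohomology_one, hA2]; ring
  -- a `ℚ`-basis `β` of `H¹(A, ℚ)` and the rational model `u = β ⊗ 1`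
  let β : Basis (Fin (4 * n)) ℚ ↥(bettiCohomology A.X 1) := Module.finBasisOfFinrankEq ℚ _ hV
  let u : Fin (4 * n) → complexBetti A.X 1 := fun i => ofRatClass (ComplexPoints A.X) 1 (β i)
  have hu : ∀ i, IsRationalClass (u i) := fun i => isRationalClass_ofRatClass _
  have hind : LinearIndependent ℂ u := by
    have hfun : (fun i => singularCohomology.ringChange (algebraMap ℚ ℂ) (ComplexPoints A.X) 1 (β i)) = u := by
      funext i
      rw [← ofRatClass_eq_ringChange]
    rw [← hfun]
    exact (linearIndependent_ringChange_iff _).mpr β.linearIndependent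
  have hcard : Fintype.card (Fin (4 * n)) = Module.finrank ℂ (complexBetti A.X 1) := by
    rw [Fintype.card_fin, Motives.AbelianVariety.finrank_complexBetti_one, hA2]; ring
  haveI : Nonempty (Fin (4 * n)) := ⟨⟨0, by omega⟩⟩
  have hspan : Submodule.span ℂ (Set.range u) = ⊤ := hind.span_eq_top_of_card_eq_finrank hcard
  -- the matrix `M` of `φ^*_ℚ = D.α` in `β`, and the Gram matrix `G = (E(βᵢ, βₖ))`
  set M : Matrix (Fin (4 * n)) (Fin (4 * n)) ℚ := LinearMap.toMatrix β β D.α with hMdef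
  have hMβ : ∀ i, D.α (β i) = ∑ k, M k i • β k := fun i => by
    conv_lhs => rw [← β.sum_repr (D.α (β i))]
    refine Finset.sum_congr rfl fun k _ => ?_
    rw [hMdef, LinearMap.toMatrix_apply]
  have hMu : ∀ i, complexBetti.map φ.hom.hom.hom 1 (u i) = ∑ k, ((M k i : ℚ) : ℂ) • u k := fun i => by
    show complexBetti.map φ.hom.hom.hom 1 (ofRatClass (ComplexPoints A.X) 1 (β i)) = _
    rw [← ofRatClass_bettiMap, ← weilDatumOfKsymm_α_apply (by omega) hA hd hφ e ha ha0 hω hω0, ← hDdef,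
      hMβ i, map_sum]
    refine Finset.sum_congr rfl fun k _ => ?_
    rw [Motives.ofRatClass_smul]
  set G : Matrix (Fin (4 * n)) (Fin (4 * n)) ℚ := fun i k => D.E (β i) (β k) with hGdef
  have hQ : ∀ v w : ↥(bettiCohomology A.X 1),
      polarizationPairingOne A.X hK m (ofRatClass (ComplexPoints A.X) 1 v)
          (ofRatClass (ComplexPoints A.X) 1 w) = ((D.E v w : ℚ) : ℂ) • ω := fun v w => by
    have hs : ((D.E v w : ℚ) : ℂ) = lineCoord ω hω0 h1 (polarizationPairingOne A.X hK m
        (ofRatClass (ComplexPoints A.X) 1 v) (ofRatClass (ComplexPoints A.X) 1 w)) :=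
      ratPolarizationForm_spec hK hhK m (lineCoord ω hω0 h1) (lineCoord_ratValued _ hω hω0) v w
    rw [hs, lineCoord_smul_self]
  have hGu : ∀ i k, polarizationPairingOne A.X hK m (u i) (u k) = ((G i k : ℚ) : ℂ) • ω :=
    fun i k => hQ (β i) (β k)
  -- multiplicities `(n, n)` from the Weil class; Hodge–Riemann in degree one for `h_K`
  obtain ⟨c, hcw, hc0, hct⟩ := hweil
  obtain ⟨hmp, hmm⟩ := weilMultiplicity_of_mem_weilClassesOf (by omega) hd hA2 hφ hcw hc0 hct
  rw [hodgeOneZero_eq_of_eq hX hX' (by omega)] at hmp hmm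
  have hHR := hodgeRiemann_degreeOne_ksymm (m := m) (by omega) hA hd φ e ha ha0
  -- the signature `(n, n)` of the model, in coordinates
  obtain ⟨P, N, hPM, hNM, hPn, hNn, hPN, hPpos, hNneg⟩ :=
    weilSignature_exists_PN hd hA hφ hmp hmm hφh hHR u hu hind hspan M hMu ω G hω hω0 hGu
  -- transport along `β`: coordinates `ι → ℚ` ≃ `H¹(A, ℚ)`
  set ε : (Fin (4 * n) → ℚ) ≃ₗ[ℚ] ↥(bettiCohomology A.X 1) := β.equivFun.symm with hεdef
  have hαε : ∀ v, D.α (ε v) = ε (M.mulVec v) := fun v => by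
    rw [hεdef, Basis.equivFun_symm_apply, Basis.equivFun_symm_apply, map_sum]
    simp_rw [map_smul, hMβ, Finset.smul_sum, smul_smul, Matrix.mulVec, dotProduct, Finset.sum_smul]
    rw [Finset.sum_comm]
    refine Finset.sum_congr rfl fun k _ => Finset.sum_congr rfl fun i _ => ?_
    rw [mul_comm]
  have hEβ : ∀ (v : Fin (4 * n) → ℚ) (y : ↥(bettiCohomology A.X 1)),
      D.E (ε v) y = ∑ i, v i * D.E (β i) y := fun v y => by
    rw [hεdef, Basis.equivFun_symm_apply, map_sum, LinearMap.sum_apply]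
    exact Finset.sum_congr rfl fun i _ => by rw [map_smul, LinearMap.smul_apply, smul_eq_mul]
  have hEβ' : ∀ (x : ↥(bettiCohomology A.X 1)) (w : Fin (4 * n) → ℚ),
      D.E x (ε w) = ∑ k, w k * D.E x (β k) := fun x w => by
    rw [hεdef, Basis.equivFun_symm_apply, map_sum]
    exact Finset.sum_congr rfl fun k _ => by rw [map_smul, smul_eq_mul]
  have hEε : ∀ v w, D.E (ε v) (ε w) = v ⬝ᵥ G.mulVec w := fun v w => by
    rw [hEβ]
    simp_rw [hEβ', dotProduct, Matrix.mulVec, dotProduct, hGdef, Finset.mul_sum]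
    exact Finset.sum_congr rfl fun i _ => Finset.sum_congr rfl fun k _ => by ring
  refine ⟨P.map (ε : (Fin (4 * n) → ℚ) →ₗ[ℚ] ↥(bettiCohomology A.X 1)),
    N.map (ε : (Fin (4 * n) → ℚ) →ₗ[ℚ] ↥(bettiCohomology A.X 1)), ?_, ?_, ?_, ?_, ?_, ?_, ?_⟩
  · rintro x ⟨v, hv, rfl⟩
    exact ⟨M.mulVec v, hPM v hv, (hαε v).symm⟩
  · rintro x ⟨v, hv, rfl⟩
    exact ⟨M.mulVec v, hNM v hv, (hαε v).symm⟩
  · rw [LinearEquiv.finrank_map_eq]; exact hPn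
  · rw [LinearEquiv.finrank_map_eq]; exact hNn
  · rw [Submodule.eq_bot_iff]
    rintro x ⟨⟨v, hv, rfl⟩, ⟨w, hw, hwv⟩⟩
    obtain rfl : w = v := ε.injective hwv
    have h0 : w ∈ P ⊓ N := ⟨hv, hw⟩
    rw [hPN, Submodule.mem_bot] at h0
    rw [h0, map_zero]
  · rintro x ⟨v, hv, rfl⟩ hx0
    have hv0 : v ≠ 0 := fun h0 => hx0 (by rw [h0, map_zero])
    change 0 < D.E (ε v) (D.α (ε v))
    rw [hαε, hEε]
    exact hPpos v hv hv0
  · rintro x ⟨v, hv, rfl⟩ hx0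
    have hv0 : v ≠ 0 := fun h0 => hx0 (by rw [h0, map_zero])
    change D.E (ε v) (D.α (ε v)) < 0
    rw [hαε, hEε]
    exact hNneg v hv hv0

end Signature

end Literature.AlgebraicGeometry.HodgeTheory

end
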